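import Summits.HodgeConjecture.CorCM.MultiFieldWeilNonIsomorphicSexticFamilies
import HarnessLib

/-!
# MULTI-FIELD WEIL ENGINE — THE INTRINSIC FAMILY THEOREM: simple CM abelian varieties of dimension `≤ 3` whose threefolds, whenever their sextic CM fields SHARE an
# imaginary quadratic field, have NON-ISOMORPHIC fields, and whenever they share none, have DIFFERENT Galois closures; surfaces up to the dihedral-triple limit; any
# curves — the Hodge conjecture for every product of copies, given ONLY Markman's fourfold theorem

Cell `pub-hodgecm2` (COR-CM), seat b30 gen 36 (2026-08-25); count-neutral own lane MULTI-FIELD WEIL ENGINE (stem `MultiFieldWeil*`), sequel of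
`CorCM/MultiFieldWeilNonIsomorphicSexticFamilies.lean` (W2: separated groups, each through one imaginary quadratic field with pairwise `Hom = ∅`).  Theorems only; no
definition, no named fact, no `sorry`.  HONEST FRAMING: conditional ONLY on `Markman2025_weilClasses_algebraic_abelianFourfold`; `HC_CM` is NOT proved and not asserted.

W2's main theorem asks the user for a labelling `b`, enumerations `e_c` of the groups, the quadratic fields `k_c` and their embeddings.  HERE ALL OF THAT IS BUILT from two
PAIRWISE conditions on the sextic slots `t ≠ t'` of a family `A_i ⊨ (K_i; Φ_i)` of SIMPLE CM abelian varieties of dimension `≤ 3`: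

* (Q1) if `K_t` and `K_{t'}` SHARE an imaginary quadratic field (a totally complex quadratic subfield of `K_t` embeds in `K_{t'}`), then `Hom(K_t, K_{t'}) = ∅`;
* (Q2) if they share NONE, their Galois closures in `ℂ` differ.

**`hodgeConjectureFor_prod_of_sharedQuadratic_isEmpty_ringHom_of_markman`**: under (Q1), (Q2) and (iii′) «among any three quartic slots with one Galois closure two carry
isogenous surfaces», the Hodge conjecture holds for EVERY product of copies `⨁_j A_{π j}` (any quadratic slots), GIVEN ONLY Markman's fourfold theorem.  PROOF: «equal, or
sextic and sharing an imaginary quadratic field» is an EQUIVALENCE relation on the slots (a sextic field has at most one quadratic subfield: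
`WeilFibre.nonempty_algEquiv_of_finrank_eq_two`); its classes, as finsets, are the labels; differently labelled sextic slots are separated by (Q2); a class whose fields
contain an imaginary quadratic field `F₀ ≤ K_{t₀}` is a group through `F₀` with pairwise `Hom = ∅` by (Q1) (W2's `hodgeConjectureFor_prod_groupBlock_of_isEmpty_ringHom`);
a class whose field contains none is a single slot carrying no curve (`hodgeConjectureFor_prod_threefoldBlock_of_markman`); the blocks glue by
`hodgeConjectureFor_prod_of_separatedLabels`, the surfaces and the free curves by `hodgeConjectureFor_prod_surfaceBlock_of_closures`.

HONEST LIMITS (the configurations excluded by (Q1)/(Q2)/(iii′)): non-isogenous threefolds over ISOMORPHIC sextic fields (seat b16's (ii′)); the sister coincidences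
`k·L_F = k′·L_{F′}` with `k ≄ k′`; two sextic CM fields without imaginary quadratic subfield sharing one Galois closure; the dihedral surface triple.

[cite: MoonenZarhin1999LowDim, Thm. (0.1), Thm. (0.2), §3 (3.1), Cor. (3.9)] [cite: Markman2025SurveySecant, Thm. 1.2] [cite: Dodson1984, §5.1.2 Theorem]
[cite: Lang2002, VI §1 Thm. 1.1 and Cor. 1.6] [cite: Shimura1998, §5.2, §8.1, §8.4] [cite: Gordon1999HodgeAVSurvey, §3 Theorem (proof), 7.5–7.7] [cite: MumfordAV1970, §19]

## References
* [MoonenZarhin1999LowDim] B. Moonen, Yu. Zarhin, Math. Ann. 315 (1999) 711–733.  [Markman2025SurveySecant] E. Markman, arXiv:2509.23403, Thm. 1.2.  [Dodson1984] B. Dodson,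
  Trans. AMS 283 (1984), §5.1.2.  [Lang2002] S. Lang, *Algebra*, GTM 211, VI §1.  [Shimura1998] G. Shimura, *Abelian varieties with complex multiplication and modular
  functions*, §5.2, §8.  [Gordon1999HodgeAVSurvey] B. B. Gordon, *A survey of the Hodge conjecture for abelian varieties*, §3, 7.4–7.7.  [MumfordAV1970] D. Mumford,
  *Abelian Varieties*, §19.
-/

noncomputable section

open CategoryTheory CategoryTheory.Limits NumberField IntermediateField

namespace Summit.HodgeConjecture.CorCM.MultiFieldWeil

open Finset
open Literature.AlgebraicGeometry Literature.AlgebraicGeometry.Motives Literature.AlgebraicGeometry.HodgeTheory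
open Literature.AlgebraicGeometry.ComplexMultiplication (IsCMTypeRealisation)
open Literature.AlgebraicTopology.SingularHomology
open Literature.NumberTheory.ComplexMultiplication
open Literature.AlgebraicGeometry.Pohlmann1968

open scoped Classical

variable {I : Type} {K : I → Type} [∀ i, Field (K i)] [∀ i, NumberField (K i)] [∀ i, IsCMField (K i)]
  {Φ : ∀ i, CMType (K i)} {A : I → AbelianVariety ℂ} {ι : ∀ i, 𝓞 (K i) →+* End (A i)} {θ : ∀ i, K i →+* Module.End ℂ (complexBetti (A i).X 1)}

/-! ## §0 Sharing an imaginary quadratic field: symmetry, transitivity through a sextic field, the common field -/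

section Shared

omit [∀ i, IsCMField (K i)] in
/-- The CM field of a realisation of dimension `≤ 3` has degree `2`, `4` or `6`. [cite: Shimura1998, §5.2] -/
private theorem finrank_eq_or_of_dim_le_three₃₆q (hA : ∀ i, IsCMTypeRealisation (Φ i) (A i) (ι i) (θ i)) {i : I} (h3 : (A i).dim ≤ 3) :
    Module.finrank ℚ (K i) = 2 ∨ Module.finrank ℚ (K i) = 4 ∨ Module.finrank ℚ (K i) = 6 := by
  have h := finrank_eq_two_mul_dim_of_isCMTypeRealisation (hA i)
  have hpos : 0 < Module.finrank ℚ (K i) := Module.finrank_pos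
  interval_cases hd : (A i).dim <;> omega

omit [∀ i, IsCMField (K i)] in
/-- An embedding of number fields `K_i ↪ K_t` makes `[K_i : ℚ]` divide `[K_t : ℚ]`. [cite: Shimura1998, §8.1] -/
private theorem finrank_dvd_of_ringHom₃₆q {i t : I} (g : K i →+* K t) : Module.finrank ℚ (K i) ∣ Module.finrank ℚ (K t) := by
  have h1 : Module.finrank ℚ ↥g.toRatAlgHom.fieldRange = Module.finrank ℚ (K i) :=
    ((AlgEquiv.ofInjectiveField g.toRatAlgHom).toLinearEquiv.finrank_eq).symm
  rw [← h1, ← IntermediateField.finrank_top' (F := ℚ) (E := K t)]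
  exact IntermediateField.finrank_dvd_of_le_right le_top

omit [∀ i, IsCMField (K i)] in
/-- **Sharing an imaginary quadratic field is symmetric**: if a totally complex quadratic subfield of `K_t` embeds in `K_{t'}`, then one of `K_{t'}` (its image) embeds in
`K_t`. [cite: Shimura1998, §8.4] -/
theorem sharedQuadratic_symm {t t' : I} (h : ∃ F : IntermediateField ℚ (K t), Module.finrank ℚ F = 2 ∧ IsTotallyComplex F ∧ Nonempty (F →+* K t')) :
    ∃ F' : IntermediateField ℚ (K t'), Module.finrank ℚ F' = 2 ∧ IsTotallyComplex F' ∧ Nonempty (F' →+* K t) := by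
  obtain ⟨F, hF2, hFtc, ⟨g⟩⟩ := h
  haveI : IsTotallyComplex F := hFtc
  exact exists_quadratic_subfield_of_ringHom_ringHom (k := F) hF2 g (algebraMap F (K t))

omit [∀ i, IsCMField (K i)] in
/-- **… and transitive through a field of degree not divisible by `4`** (such a field has at most one quadratic subfield, so the two shared fields coincide in `K_{t'}`).
[cite: Lang2002, VI §1 Thm. 1.1 and Cor. 1.6] -/
theorem sharedQuadratic_trans {t t' t'' : I} (h4 : ¬ 4 ∣ Module.finrank ℚ (K t'))
    (h : ∃ F : IntermediateField ℚ (K t), Module.finrank ℚ F = 2 ∧ IsTotallyComplex F ∧ Nonempty (F →+* K t'))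
    (h' : ∃ F' : IntermediateField ℚ (K t'), Module.finrank ℚ F' = 2 ∧ IsTotallyComplex F' ∧ Nonempty (F' →+* K t'')) :
    ∃ F : IntermediateField ℚ (K t), Module.finrank ℚ F = 2 ∧ IsTotallyComplex F ∧ Nonempty (F →+* K t'') := by
  obtain ⟨F, hF2, hFtc, ⟨g⟩⟩ := h
  obtain ⟨F', hF'2, -, ⟨g'⟩⟩ := h'
  obtain ⟨φ⟩ := WeilFibre.nonempty_algEquiv_of_finrank_eq_two (M := K t') hF2 hF'2 h4 g.toRatAlgHom F'.val
  exact ⟨F, hF2, hFtc, ⟨g'.comp φ.toRingEquiv.toRingHom⟩⟩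

omit [∀ i, IsCMField (K i)] in
/-- **The common field**: if `K_t` (degree not divisible by `4`) shares an imaginary quadratic field with `K_{t'}`, then EVERY quadratic subfield `F₀ ≤ K_t` embeds in `K_{t'}`.
[cite: Lang2002, VI §1 Thm. 1.1 and Cor. 1.6] -/
theorem nonempty_ringHom_of_sharedQuadratic {t t' : I} (h4 : ¬ 4 ∣ Module.finrank ℚ (K t)) (F₀ : IntermediateField ℚ (K t))
    (hF₀ : Module.finrank ℚ F₀ = 2) (h : ∃ F : IntermediateField ℚ (K t), Module.finrank ℚ F = 2 ∧ IsTotallyComplex F ∧ Nonempty (F →+* K t')) :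
    Nonempty (F₀ →+* K t') := by
  obtain ⟨F, hF2, -, ⟨g⟩⟩ := h
  obtain ⟨φ⟩ := WeilFibre.nonempty_algEquiv_of_finrank_eq_two (M := K t) hF₀ hF2 h4 F₀.val F.val
  exact ⟨g.comp φ.toRingEquiv.toRingHom⟩

end Shared

/-! ## §1 The intrinsic family theorem -/

section Family

variable [Fintype I]

/-- **MAIN THEOREM — SIMPLE CM ABELIAN VARIETIES OF DIMENSION `≤ 3`: THREEFOLDS SHARING AN IMAGINARY QUADRATIC FIELD HAVE NON-ISOMORPHIC FIELDS, THREEFOLDS SHARING NONE HAVE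
DIFFERENT GALOIS CLOSURES; SURFACES UP TO THE DIHEDRAL-TRIPLE LIMIT; ANY CURVES — given ONLY Markman's fourfold theorem.**  `A_i ⊨ (K_i; Φ_i)` (`i ∈ I` finite) SIMPLE of
dimension `≤ 3` such that for all sextic slots `t ≠ t'`: (Q1) if a totally complex quadratic subfield of `K_t` embeds in `K_{t'}` then `Hom(K_t, K_{t'}) = ∅`; (Q2) if none
does then `L(K_t) ≠ L(K_{t'})`; and (iii′) among any three quartic slots with one Galois closure two carry isogenous surfaces.  Then the Hodge conjecture holds for every
product of copies `⨁_j A_{π j}`.  No labelling, no enumeration, no choice of quadratic fields is asked for: they are built here.  `HC_CM` is NOT asserted.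
[cite: MoonenZarhin1999LowDim, Thm. (0.1), Thm. (0.2), §3 (3.1), Cor. (3.9)] [cite: Markman2025SurveySecant, Thm. 1.2] [cite: Dodson1984, §5.1.2 Theorem]
[cite: Lang2002, VI §1 Thm. 1.1 and Cor. 1.6] [cite: Gordon1999HodgeAVSurvey, §3 Theorem (proof), 7.5–7.7] -/
theorem hodgeConjectureFor_prod_of_sharedQuadratic_isEmpty_ringHom_of_markman (hW4 : Markman2025_weilClasses_algebraic_abelianFourfold)
    (hA : ∀ i, IsCMTypeRealisation (Φ i) (A i) (ι i) (θ i)) (hS : ∀ i, (A i).IsSimple) (h3 : ∀ i, (A i).dim ≤ 3)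
    (hQ : ∀ t t' : I, t ≠ t' → Module.finrank ℚ (K t) = 6 → Module.finrank ℚ (K t') = 6 →
      ((∃ F : IntermediateField ℚ (K t), Module.finrank ℚ F = 2 ∧ IsTotallyComplex F ∧ Nonempty (F →+* K t')) → IsEmpty (K t →+* K t')) ∧
      ((¬ ∃ F : IntermediateField ℚ (K t), Module.finrank ℚ F = 2 ∧ IsTotallyComplex F ∧ Nonempty (F →+* K t')) →
        normalClosure ℚ (K t) ℂ ≠ normalClosure ℚ (K t') ℂ))
    (hS3 : ∀ x y z : I, Module.finrank ℚ (K x) = 4 → Module.finrank ℚ (K y) = 4 → Module.finrank ℚ (K z) = 4 →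
      normalClosure ℚ (K x) ℂ = normalClosure ℚ (K y) ℂ → normalClosure ℚ (K y) ℂ = normalClosure ℚ (K z) ℂ →
      AbelianVariety.IsIsogenous (A x) (A y) ∨ AbelianVariety.IsIsogenous (A x) (A z) ∨ AbelianVariety.IsIsogenous (A y) (A z))
    {N : ℕ} (π : Fin N → I) : HodgeConjectureFor (⨁ fun j => A (π j)).dim (⨁ fun j => A (π j)).X := by
  classical
  -- the relation «equal, or sextic slots sharing an imaginary quadratic field»; it is an equivalence relation
  let R : I → I → Prop := fun t t' => t = t' ∨ (Module.finrank ℚ (K t) = 6 ∧ Module.finrank ℚ (K t') = 6 ∧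
    ∃ F : IntermediateField ℚ (K t), Module.finrank ℚ F = 2 ∧ IsTotallyComplex F ∧ Nonempty (F →+* K t'))
  have h46 : ∀ t, Module.finrank ℚ (K t) = 6 → ¬ 4 ∣ Module.finrank ℚ (K t) := fun t ht => by rw [ht]; decide
  have hRrefl : ∀ t, R t t := fun t => Or.inl rfl
  have hRsymm : ∀ t t', R t t' → R t' t := by
    rintro t t' (rfl | ⟨ht, ht', h⟩)
    exacts [Or.inl rfl, Or.inr ⟨ht', ht, sharedQuadratic_symm h⟩]
  have hRtrans : ∀ t t' t'', R t t' → R t' t'' → R t t'' := by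
    rintro t t' t'' (rfl | ⟨ht, ht', h⟩) h₂
    · exact h₂
    · rcases h₂ with rfl | ⟨-, ht'', h'⟩
      · exact Or.inr ⟨ht, ht', h⟩
      · exact Or.inr ⟨ht, ht'', sharedQuadratic_trans (h46 t' ht') h h'⟩
  -- the classes, as finsets, are the labels
  let b : I → Finset I := fun t => Finset.univ.filter (R t)
  have hb : ∀ t t', b t = b t' ↔ R t t' := by
    intro t t'
    refine ⟨fun h => ?_, fun h => ?_⟩
    · have ht' : t' ∈ b t := by rw [h]; exact Finset.mem_filter.2 ⟨Finset.mem_univ _, hRrefl t'⟩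
      exact (Finset.mem_filter.1 ht').2
    · ext x
      simp only [b, Finset.mem_filter, Finset.mem_univ, true_and]
      exact ⟨fun hx => hRtrans _ _ _ (hRsymm _ _ h) hx, fun hx => hRtrans _ _ _ h hx⟩
  -- differently labelled sextic slots are separated, by (Q2)
  have hsep : ∀ t t', Module.finrank ℚ (K t) = 6 → Module.finrank ℚ (K t') = 6 → b t ≠ b t' →
      normalClosure ℚ (K t) ℂ ≠ normalClosure ℚ (K t') ℂ ∧
        ¬ ∃ F : IntermediateField ℚ (K t), Module.finrank ℚ F = 2 ∧ IsTotallyComplex F ∧ Nonempty (F →+* K t') := by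
    intro t t' ht ht' hne
    have hR : ¬ R t t' := fun h => hne ((hb t t').2 h)
    have htt : t ≠ t' := fun h => hR (Or.inl h)
    have hsh : ¬ ∃ F : IntermediateField ℚ (K t), Module.finrank ℚ F = 2 ∧ IsTotallyComplex F ∧ Nonempty (F →+* K t') := fun h => hR (Or.inr ⟨ht, ht', h⟩)
    exact ⟨(hQ t t' htt ht ht').2 hsh, hsh⟩
  refine hodgeConjectureFor_prod_of_separatedLabels hA hS h3 b hsep (fun c M ρ hρ => ?_) (fun M ρ hρ => ?_) π
  · cases M with
    | zero => exact hodgeConjectureFor_of_isDivisorGenerated _ (isDivisorGenerated_of_dim_eq_zero _ (dim_biproduct_fin_zero _))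
    | succ M =>
      obtain ⟨t₀, ht₀, -, hb₀⟩ := hρ 0
      -- every member: a curve through a sextic field of the class, or a sextic slot of the class
      have hmem : ∀ l, (Module.finrank ℚ (K (ρ l)) = 2 ∧ ∃ t, Module.finrank ℚ (K t) = 6 ∧ Nonempty (K (ρ l) →+* K t) ∧ b t = c) ∨
          (Module.finrank ℚ (K (ρ l)) = 6 ∧ b (ρ l) = c) := by
        intro l
        obtain ⟨t, ht, ⟨g⟩, hbt⟩ := hρ l
        rcases finrank_eq_or_of_dim_le_three₃₆q hA (h3 (ρ l)) with h2 | h4 | h6'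
        · exact Or.inl ⟨h2, t, ht, ⟨g⟩, hbt⟩
        · exfalso
          have h := finrank_dvd_of_ringHom₃₆q g
          rw [h4, ht] at h
          omega
        · exact Or.inr ⟨h6', (label_eq_of_ringHom_ringHom hA h3 b hsep h6' ht (RingHom.id _) g).trans hbt⟩
      -- the sextic slots of the class are related to `t₀`
      have hcls : ∀ t, Module.finrank ℚ (K t) = 6 → b t = c → R t₀ t := fun t _ hbt => (hb t₀ t).1 (hb₀.trans hbt.symm)
      by_cases hK : ∃ F : IntermediateField ℚ (K t₀), Module.finrank ℚ F = 2 ∧ IsTotallyComplex F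
      · -- (ii) a group through the imaginary quadratic field `F₀ ≤ K_{t₀}`
        obtain ⟨F₀, hF₀2, hF₀tc⟩ := hK
        haveI : IsTotallyComplex F₀ := hF₀tc
        haveI : IsCMField F₀ := isCMField_of_isTotallyComplex_of_finrank_two hF₀2
        -- enumerate the sextic slots of the class
        let s : Finset I := Finset.univ.filter fun t => Module.finrank ℚ (K t) = 6 ∧ b t = c
        let e : Fin s.card → I := fun m => (s.equivFin.symm m).1
        have he_mem : ∀ m, Module.finrank ℚ (K (e m)) = 6 ∧ b (e m) = c := fun m => (Finset.mem_filter.1 (s.equivFin.symm m).2).2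
        have he_inj : Function.Injective e := fun m m' h => s.equivFin.symm.injective (Subtype.ext h)
        have he_surj : ∀ t, Module.finrank ℚ (K t) = 6 → b t = c → ∃ m, t = e m := fun t ht hbt =>
          ⟨s.equivFin ⟨t, Finset.mem_filter.2 ⟨Finset.mem_univ _, ht, hbt⟩⟩, by simp only [e, Equiv.symm_apply_apply]⟩
        -- `F₀` embeds in every field of the class
        have hF₀emb : ∀ m, Nonempty (F₀ →+* K (e m)) := by
          intro m
          rcases hcls (e m) (he_mem m).1 (he_mem m).2 with h | ⟨-, -, hsh⟩
          · obtain ⟨g⟩ : Nonempty (K t₀ →+* K (e m)) := h ▸ ⟨RingHom.id (K t₀)⟩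
            exact ⟨g.comp (algebraMap F₀ (K t₀))⟩
          · exact nonempty_ringHom_of_sharedQuadratic (h46 t₀ ht₀) F₀ hF₀2 hsh
        let i : ∀ m, F₀ →+* K (e m) := fun m => Classical.choice (hF₀emb m)
        obtain ⟨τ⟩ : Nonempty (F₀ →+* ℂ) := inferInstance
        -- pairwise no homomorphisms inside the class, by (Q1)
        have hiso : ∀ m₀ m : Fin s.card, m₀ ≠ m → IsEmpty (K (e m) →+* K (e m₀)) := by
          intro m₀ m hm
          have hne : e m ≠ e m₀ := fun h => hm (he_inj h).symm
          exact (hQ (e m) (e m₀) hne (he_mem m).1 (he_mem m₀).1).1 (exists_quadratic_subfield_of_ringHom_ringHom hF₀2 (i m) (i m₀))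
        refine hodgeConjectureFor_prod_groupBlock_of_isEmpty_ringHom hW4 hA hS e (fun m => (he_mem m).1) hF₀2 i τ hiso ρ fun l => ?_
        rcases hmem l with ⟨h2, t, ht, hg, hbt⟩ | ⟨h6', hbl⟩
        · obtain ⟨m, rfl⟩ := he_surj t ht hbt
          exact Or.inl ⟨h2, m, hg⟩
        · exact Or.inr (he_surj (ρ l) h6' hbl)
      · -- (i) `K_{t₀}` has no imaginary quadratic subfield: the class is `{t₀}`, and no curve lies in the block
        have honly : ∀ t, Module.finrank ℚ (K t) = 6 → b t = c → t = t₀ := by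
          intro t ht hbt
          rcases hcls t ht hbt with h | ⟨-, -, ⟨F, hF2, hFtc, -⟩⟩
          · exact h.symm
          · exact absurd ⟨F, hF2, hFtc⟩ hK
        refine hodgeConjectureFor_prod_threefoldBlock_of_markman hW4 hA hS ht₀ ht₀ ρ fun l => ?_
        rcases hmem l with ⟨h2, t, ht, ⟨g⟩, hbt⟩ | ⟨h6', hbl⟩
        · exfalso
          obtain rfl := honly t ht hbt
          obtain ⟨F, hF2, hFtc, -⟩ := exists_quadratic_subfield_of_ringHom_ringHom (k := K (ρ l)) h2 g g
          exact hK ⟨F, hF2, hFtc⟩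
        · exact Or.inr (Or.inl (honly (ρ l) h6' hbl))
  · exact hodgeConjectureFor_prod_surfaceBlock_of_closures hA hS h3 hS3 ρ fun l h6' => hρ l ⟨ρ l, h6', ⟨RingHom.id _⟩⟩

/-- **Dominated form.** [cite: MoonenZarhin1999LowDim, Thm. (0.1), (0.2)] [cite: Markman2025SurveySecant, Thm. 1.2] [cite: MumfordAV1970, §19 Thm. 1 and p. 169] -/
theorem hodgeConjectureFor_of_avDominatedBy_prod_of_sharedQuadratic_isEmpty_ringHom_of_markman (hW4 : Markman2025_weilClasses_algebraic_abelianFourfold)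
    (hA : ∀ i, IsCMTypeRealisation (Φ i) (A i) (ι i) (θ i)) (hS : ∀ i, (A i).IsSimple) (h3 : ∀ i, (A i).dim ≤ 3)
    (hQ : ∀ t t' : I, t ≠ t' → Module.finrank ℚ (K t) = 6 → Module.finrank ℚ (K t') = 6 →
      ((∃ F : IntermediateField ℚ (K t), Module.finrank ℚ F = 2 ∧ IsTotallyComplex F ∧ Nonempty (F →+* K t')) → IsEmpty (K t →+* K t')) ∧
      ((¬ ∃ F : IntermediateField ℚ (K t), Module.finrank ℚ F = 2 ∧ IsTotallyComplex F ∧ Nonempty (F →+* K t')) →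
        normalClosure ℚ (K t) ℂ ≠ normalClosure ℚ (K t') ℂ))
    (hS3 : ∀ x y z : I, Module.finrank ℚ (K x) = 4 → Module.finrank ℚ (K y) = 4 → Module.finrank ℚ (K z) = 4 →
      normalClosure ℚ (K x) ℂ = normalClosure ℚ (K y) ℂ → normalClosure ℚ (K y) ℂ = normalClosure ℚ (K z) ℂ →
      AbelianVariety.IsIsogenous (A x) (A y) ∨ AbelianVariety.IsIsogenous (A x) (A z) ∨ AbelianVariety.IsIsogenous (A y) (A z))
    {N : ℕ} (π : Fin N → I) {X : AbelianVariety ℂ} (hX : Domination.AVDominatedBy X (⨁ fun j => A (π j))) : HodgeConjectureFor X.dim X.X :=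
  Domination.hodgeConjectureFor_of_avDominatedBy (hodgeConjectureFor_prod_of_sharedQuadratic_isEmpty_ringHom_of_markman hW4 hA hS h3 hQ hS3 π) hX

end Family

end Summit.HodgeConjecture.CorCM.MultiFieldWeil

end
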